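import Literature.MathematicalPhysics.QuantumFieldTheory.Balaban1983to89.B1Eq324BenfattoSect5Eq536
import HarnessLib

/-!
# `Balaban1983to89.B1Eq324BenfattoSect5UpperStep` — [BenfattoEtAl1978] §5 p. 159, (5.36) → (4.6): the upper pavement step under
# `P̄ = P̂₀(·|z̄_C)` in the form the per-box SUPPLIER discharges for `C ≠ ∅` (per-box hypotheses only at corridor data `ξ` with `ξ = z̄` on `C`,
# resp. only at `ξ` small on `C ∪ Γ₁`), PROVED for the tree's objects

statement-level skeleton of published theorems with citation tags; proofs where landed; nothing here is a claim about the
Yang–Mills mass gap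

WHY THIS MODULE (cell `pub-ymgap`, seat `dag-n08-d` gen 10, INTENT-40; node N08 [Balaban1985UV3]; the [BenfattoEtAl1978] source chain behind the
(α)-row `h324c`).  `…Sect5Eq536.upperPavementStep_cond_of_setIntegral_gamma` (seat gen 9, v1.1) proves the (5.36) chain under `P̄ = condField C z̄`
with per-box UPPER hypotheses quantified over ALL corridor data `ξ ∈ χ^{Γ₁}_{γb}` — including arbitrary values of `ξ` on the conditioning set `C`.
For `C ≠ ∅` that is more than the per-box line can supply: App. C Lemma 2 / (C.8) under `P̂₀(·|ξ_{C∪Γ₁})` reads the centre `condMean` off EVERY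
conditioning value, so the supplier (`…Sect5PerBoxAppD.perBox_condField_appD` at `Γ := C ∪ Γ₁(□)`) needs `|ξ_c| ≤ γb(1 + d(c, I))` on `C` as well
(design-review note of seat `dag-n08-c` gen 19, 2026-08-27).  Print assumes exactly this — p. 159: *"then assuming |z_Δ| ≦ b(1 + d(Δ, I)), ∀Δ ∈ C"* —
and the chain only ever integrates `ξ` with `ξ = z̄` on `C`, `P̄`-almost surely (`…Sect5Eq515.condField_ae_eqOn`).  This file re-runs the v1.1 chain
with the per-box hypotheses used only almost surely, and packages the result in the two forms the (4.6) assembler consumes.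

WHAT IS PROVED (standard axioms; no `sorry`; no definition).
* §1 `integral_cutoffBoltzmann_condField_eq_zero_of_not_mem` — if the conditioning values `z̄` violate the small-field condition somewhere on `C`
  (`z̄ ∉ χ^{C}_{c}`), the (4.6)-integrand `Π_Δχ̂^{c}_Δ e^{H}` vanishes `P̄`-a.s. and `∫ Π_Δχ̂^{c}_Δ e^{H} dP̄ = 0` (the (4.6) bound is then trivial);
  `integral_cutoffBoltzmann_nonneg`.
* §2 ★★★ `upperPavementStep_cond_of_setIntegral_gamma'` — the statement of `…Sect5Eq536.upperPavementStep_cond_of_setIntegral_gamma` with the per-box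
  hypothesis weakened by the extra antecedent `∀ c ∈ C, ξ c = z̄ c` (same (5.36) chain; the pointwise step (U3) becomes an a.e. step via
  `condField_ae_eqOn`).
* §3 ★★★ `upperPavementStep_cond_of_setIntegral_gamma_union` — the same conclusion for ANY `z̄`, with the per-box hypothesis asked only for `ξ` SMALL ON
  `C ∪ Γ₁` at threshold `γb` (`ξ ∈ smallFieldOn ↑(C ∪ corridors L w B) I (γb)`, literally the `hξ` of `perBox_condField_appD` at `Γ := C ∪ Γ₁`):
  if `z̄` is small on `C` this is §2, otherwise the left-hand side is `0` by §1.
HONEST SCOPE.  Structural; the per-box UPPER bounds themselves, the geometric side conditions of the supplier at `Γ := C ∪ Γ₁(□)` (`C` at distance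
`≥ b³` from `J`), the cumulant identification and the constants are not here; count-neutral for N08; `BasicLemmaPrinted` NOT discharged; nothing about
d = 4, the continuum, OS axioms, a mass gap or the Clay problem.
-/

noncomputable section

open Finset MeasureTheory
open scoped BigOperators

namespace Literature.MathematicalPhysics.QuantumFieldTheory.Balaban1983to89.B1Eq324BenfattoSect5UpperStep

open _root_.MeasureTheory _root_.ProbabilityTheory
open Literature.MathematicalPhysics.QuantumFieldTheory.Balaban1983to89.B3Sect3VectorSelfEnergy (ZSite unitVec)
open Literature.MathematicalPhysics.QuantumFieldTheory.Balaban1983to89.B1Eq324BenfattoLemma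
open Literature.MathematicalPhysics.QuantumFieldTheory.Balaban1983to89.B1Eq324BenfattoSect5Boxes
open Literature.MathematicalPhysics.QuantumFieldTheory.Balaban1983to89.B1Eq324BenfattoSect5Eq511
open Literature.MathematicalPhysics.QuantumFieldTheory.Balaban1983to89.B1Eq324BenfattoSect5Eq524
open Literature.MathematicalPhysics.QuantumFieldTheory.Balaban1983to89.B1Eq324BenfattoSect5Eq534
open Literature.MathematicalPhysics.QuantumFieldTheory.Balaban1983to89.B1Eq324BenfattoSect5Eq515
open Literature.MathematicalPhysics.QuantumFieldTheory.Balaban1983to89.B1Eq324BenfattoAppendixC2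
open Literature.MathematicalPhysics.QuantumFieldTheory.Balaban1983to89.B1Eq324BenfattoAppendixCLemma2
open Literature.MathematicalPhysics.QuantumFieldTheory.Balaban1983to89.B1Eq324BenfattoMarkov
open Literature.MathematicalPhysics.QuantumFieldTheory.Balaban1983to89.B1Eq324BenfattoTwoStageLaw
open Literature.MathematicalPhysics.QuantumFieldTheory.Balaban1983to89.B1Eq324BenfattoSect5Eq535
open Literature.MathematicalPhysics.QuantumFieldTheory.Balaban1983to89.B1Eq324BenfattoSect5Iteration
open Literature.MathematicalPhysics.QuantumFieldTheory.Balaban1983to89.B1Eq324BenfattoSect5PavementStep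
open Literature.MathematicalPhysics.QuantumFieldTheory.Balaban1983to89.B1Eq324BenfattoSect5Eq536
open Literature.MathematicalPhysics.QuantumFieldTheory.Balaban1983to89.B1Eq324BenfattoSect5SlotMoments (distToRegion_eq_zero_of_mem)

variable {d : ℕ} {α β : ℝ}

/-! ## §1  The (4.6)-integrand vanishes under `P̄` when `z̄` is not small on `C` -/

section Vanishing

/-- **`∫ Π_Δχ̂^{c}_Δ e^{H} dP̂₀(·|z̄_C) = 0` when the conditioning values violate the small-field condition on `C`**: under `P̄ = condField C z̄` the
`C`-coordinates equal `z̄` almost surely (`condField_ae_eqOn`), so if `|z̄_x| > c(1 + d(x, I))` for some `x ∈ C` the global small-field indicator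
`Π_Δχ̂^{c}_Δ` vanishes a.s.  (This is why print may assume `|z_Δ| ≦ b(1 + d(Δ, I)) ∀Δ ∈ C` in (4.6), p. 152 / p. 159: otherwise the left-hand side of
(4.6) is `0`.) [cite: BenfattoEtAl1978, (4.6) p.152, §5 p.159] -/
theorem integral_cutoffBoltzmann_condField_eq_zero_of_not_mem (hα : 0 < α) (hβ : 0 < β) (C : Finset (B1Eq324BenfattoLemma.Site d))
    (zbar : B1Eq324BenfattoLemma.Site d → ℝ) (H : (B1Eq324BenfattoLemma.Site d → ℝ) → ℝ) (I : Finset (B1Eq324BenfattoLemma.Site d)) {c : ℝ}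
    (hz : zbar ∉ smallFieldOn (C : Set (B1Eq324BenfattoLemma.Site d)) I c) :
    ∫ z, cutoffBoltzmann H I c z ∂condField d α β C zbar = 0 := by
  have hae : ∀ᵐ z ∂condField d α β C zbar, cutoffBoltzmann H I c z = 0 := by
    filter_upwards [condField_ae_eqOn hα hβ C zbar] with z hzC
    have hz' : z ∉ smallFieldSet I c := by
      intro hmem
      apply hz
      intro x hx
      rw [← hzC x (Finset.mem_coe.mp hx)]
      exact hmem x
    simp only [cutoffBoltzmann, Set.indicator_of_notMem hz']
  rw [integral_congr_ae hae, integral_zero]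

/-- `∫ Π_Δχ̂^{c}_Δ e^{H} dμ ≥ 0` for any measure (the integrand is a non-negative indicator times an exponential). [cite: BenfattoEtAl1978, (4.6) p.152] -/
theorem integral_cutoffBoltzmann_nonneg (μ : Measure (B1Eq324BenfattoLemma.Site d → ℝ)) (H : (B1Eq324BenfattoLemma.Site d → ℝ) → ℝ)
    (I : Finset (B1Eq324BenfattoLemma.Site d)) (c : ℝ) : 0 ≤ ∫ z, cutoffBoltzmann H I c z ∂μ :=
  integral_nonneg fun z => by
    rw [cutoffBoltzmann]
    exact Set.indicator_nonneg (fun _ _ => (Real.exp_pos _).le) _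

end Vanishing

/-! ## §2  The upper pavement step under `P̄` with print's `γ`, per-box hypotheses only at `ξ = z̄` on `C` -/

section UpperGammaPrime

variable {s D : ℕ} {κ : ℝ} {a : Coef d} {J I : Finset (B1Eq324BenfattoLemma.Site d)} {L w v : ℕ}
  {B : Finset (B1Eq324BenfattoLemma.Site d)} {γ b A : ℝ}

/-- kernel: the conditional expectation of an observable bounded by `M` is bounded by `M`. [folklore] -/
private theorem abs_integral_condField_le_of_bound (hα : 0 < α) (hβ : 0 < β) (Γ : Finset (B1Eq324BenfattoLemma.Site d))
    (ξ : B1Eq324BenfattoLemma.Site d → ℝ) {φ : (B1Eq324BenfattoLemma.Site d → ℝ) → ℝ} {M : ℝ} (hφ : ∀ z, |φ z| ≤ M) :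
    |∫ z, φ z ∂condField d α β Γ ξ| ≤ M := by
  haveI := isProbabilityMeasure_condField hα hβ Γ ξ
  have h := norm_integral_le_of_norm_le_const (μ := condField d α β Γ ξ) (f := φ) (C := M)
    (ae_of_all _ fun z => by rw [Real.norm_eq_abs]; exact hφ z)
  rwa [probReal_univ, mul_one, Real.norm_eq_abs] at h

/-- **THE UPPER PAVEMENT STEP UNDER `P̄`, WITH PRINT'S `γ`, PER-BOX HYPOTHESES ONLY AT `ξ = z̄` ON `C`** (p. 159: *"then assuming |z_Δ| ≦ b(1+d(Δ,I)),
∀Δ ∈ C: [(5.12)] ≦ … (5.36) … bounded above by the r.h.s. of (5.35) with b replaced by γ⁻¹b"*).  Literally the statement of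
`…Sect5Eq536.upperPavementStep_cond_of_setIntegral_gamma` — INPUT cut-offs at threshold `γb`, box interiors, far block and OUTPUT at threshold `b`,
`∫ Π_Δχ̂^{γb}_Δ e^{H^A_J} dP̄ ≤ exp(err₅₁₁(γb) + err₅₃₄(b) + Σ_{□∈B}u_□)·∫ Π_Δχ̂^{b}_Δ e^{H^{A|Γ̄₁}_{J∩Γ̄₁}} dP̄`, `P̄ = condField C z̄` — except that the per-box
UPPER hypotheses `∫_{χ^□_b}e^{Ψ_□} dP̂₀(·|ξ_{C∪Γ₁}) ≤ e^{u_□}·∫_{χ^□_b}e^{Ψ′₁+Ψ₂} dP̂₀(·|ξ_{C∪Γ₁})` are asked only for corridor data `ξ` with `χ^{Γ₁}_{γb}(ξ) = 1`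
AND `ξ_c = z̄_c` for all `c ∈ C` (the only `ξ` the chain integrates, `P̄`-a.s., by `condField_ae_eqOn`).  Same proof as the v1.1 theorem with the
pointwise per-box step replaced by an almost-sure one. [cite: BenfattoEtAl1978, §5 (5.36) p.159, (4.6) p.152] -/
theorem upperPavementStep_cond_of_setIntegral_gamma' (hα : 0 < α) (hβ : 0 < β) (hκ : 0 < κ) (hJ : CoefSupportedIn a J) (hA0 : 0 ≤ A)
    (C : Finset (B1Eq324BenfattoLemma.Site d)) (zbar : B1Eq324BenfattoLemma.Site d → ℝ)
    (hA : ∀ p ∈ Finset.Icc 1 s, ∀ (Δ : Fin p → B1Eq324BenfattoLemma.Site d), (∀ i, Δ i ∈ J) →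
      ∀ n ∈ admissible p D, |a p Δ n| ≤ A)
    (hJI : J ⊆ I) (hL : 0 < L) (hw : 1 ≤ w) (hv : v ≤ w) (hB : J.image (boxIndex L) ⊆ B) (hγ : γ ≤ 1) (hb : 1 ≤ b) (hγb : 1 ≤ γ * b)
    (u : B1Eq324BenfattoLemma.Site d → ℝ)
    (hbox : ∀ m ∈ B, ∀ ξ : B1Eq324BenfattoLemma.Site d → ℝ, ξ ∈ smallFieldOn (corridors L w B : Set (B1Eq324BenfattoLemma.Site d)) I (γ * b) →
      (∀ c ∈ C, ξ c = zbar c) →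
      ∫ z in smallFieldOn (shrink L m w : Set (B1Eq324BenfattoLemma.Site d)) I b,
          Real.exp (psiBox s D κ a L w m z) ∂condField d α β (C ∪ corridors L w B) ξ
        ≤ Real.exp (u m) * ∫ z in smallFieldOn (shrink L m w : Set (B1Eq324BenfattoLemma.Site d)) I b,
          Real.exp (psi1p s D κ a L w v m z + psi2 s D κ a L w m z) ∂condField d α β (C ∪ corridors L w B) ξ) :
    ∫ z, cutoffBoltzmann (hamiltonian s D κ a J) I (γ * b) z ∂condField d α β C zbar ≤
      Real.exp (s1Const s D d κ * A * (γ * b) ^ D * Real.exp (-(κ / 4 * w)) * J.card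
        + s1Const s D d κ * A * b ^ D *
          (Real.exp (-(κ / 4 * w)) * (corridorsBar L w v B).card + Real.exp (-(κ / 4 * v)) * (B.card * (L : ℝ) ^ d))
        + ∑ m ∈ B, u m) *
        ∫ z, cutoffBoltzmann (hamiltonian s D κ (restrictCoef a (corridorsBar L w v B)) (J ∩ corridorsBar L w v B)) I b z ∂condField d α β C zbar := by
  haveI : IsProbabilityMeasure (condField d α β C zbar) := isProbabilityMeasure_condField hα hβ C zbar
  set Γ : Finset (B1Eq324BenfattoLemma.Site d) := corridors L w B with hΓ
  set e511 : ℝ := s1Const s D d κ * A * (γ * b) ^ D * Real.exp (-(κ / 4 * w)) * J.card with he511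
  set e534 : ℝ := s1Const s D d κ * A * b ^ D *
    (Real.exp (-(κ / 4 * w)) * (corridorsBar L w v B).card + Real.exp (-(κ / 4 * v)) * (B.card * (L : ℝ) ^ d)) with he534
  have hb0 : (0 : ℝ) ≤ b := zero_le_one.trans hb
  have hγb_le : γ * b ≤ b := by nlinarith
  -- the two factorised z-integrands at `γ = 1`
  set IF : (B1Eq324BenfattoLemma.Site d → ℝ) → ℝ := fun z =>
    (smallFieldOn (Γ : Set (B1Eq324BenfattoLemma.Site d)) I (γ * b)).indicator (fun _ => (1 : ℝ)) z * Real.exp (hamiltonian s D κ a Γ z) *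
      ((smallFieldOn (out L B) I b).indicator (fun _ => (1 : ℝ)) z *
        ∏ m ∈ B, (smallFieldOn (frame1 L w m : Set (B1Eq324BenfattoLemma.Site d)) I (γ * b)).indicator (fun _ => (1 : ℝ)) z *
            (smallFieldOn (shrink L m w : Set (B1Eq324BenfattoLemma.Site d)) I b).indicator (fun _ => (1 : ℝ)) z * Real.exp (psiBox s D κ a L w m z))
    with hIF
  set IG : (B1Eq324BenfattoLemma.Site d → ℝ) → ℝ := fun z =>
    (smallFieldOn (Γ : Set (B1Eq324BenfattoLemma.Site d)) I (γ * b)).indicator (fun _ => (1 : ℝ)) z * Real.exp (hamiltonian s D κ a Γ z) *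
      ((smallFieldOn (out L B) I b).indicator (fun _ => (1 : ℝ)) z *
        ∏ m ∈ B, (smallFieldOn (frame1 L w m : Set (B1Eq324BenfattoLemma.Site d)) I (γ * b)).indicator (fun _ => (1 : ℝ)) z *
            (smallFieldOn (shrink L m w : Set (B1Eq324BenfattoLemma.Site d)) I b).indicator (fun _ => (1 : ℝ)) z *
            Real.exp (psi1p s D κ a L w v m z + psi2 s D κ a L w m z))
    with hIG
  -- the ξ-side factors
  set pre : (B1Eq324BenfattoLemma.Site d → ℝ) → ℝ := fun ξ =>
    (smallFieldOn (Γ : Set (B1Eq324BenfattoLemma.Site d)) I (γ * b)).indicator (fun _ => (1 : ℝ)) ξ * Real.exp (hamiltonian s D κ a Γ ξ) with hpre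
  set OUT : (B1Eq324BenfattoLemma.Site d → ℝ) → ℝ := fun ξ =>
    ∫ z, (smallFieldOn (out L B) I b).indicator (fun _ => (1 : ℝ)) z ∂condField d α β (C ∪ Γ) ξ with hOUT
  set F : B1Eq324BenfattoLemma.Site d → (B1Eq324BenfattoLemma.Site d → ℝ) → ℝ := fun m ξ =>
    ∫ z, (smallFieldOn (frame1 L w m : Set (B1Eq324BenfattoLemma.Site d)) I (γ * b)).indicator (fun _ => (1 : ℝ)) z *
        (smallFieldOn (shrink L m w : Set (B1Eq324BenfattoLemma.Site d)) I b).indicator (fun _ => (1 : ℝ)) z *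
        Real.exp (psiBox s D κ a L w m z) ∂condField d α β (C ∪ Γ) ξ with hF
  set G : B1Eq324BenfattoLemma.Site d → (B1Eq324BenfattoLemma.Site d → ℝ) → ℝ := fun m ξ =>
    ∫ z, (smallFieldOn (frame1 L w m : Set (B1Eq324BenfattoLemma.Site d)) I (γ * b)).indicator (fun _ => (1 : ℝ)) z *
        (smallFieldOn (shrink L m w : Set (B1Eq324BenfattoLemma.Site d)) I b).indicator (fun _ => (1 : ℝ)) z *
        Real.exp (psi1p s D κ a L w v m z + psi2 s D κ a L w m z) ∂condField d α β (C ∪ Γ) ξ with hG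
  have hWbF : ∀ m, ∀ z : B1Eq324BenfattoLemma.Site d → ℝ, (∀ x ∈ J, x ∈ box L m → |z x| ≤ b) →
      |psiBox s D κ a L w m z| ≤ 2 * s1Const s D d κ * A * b ^ D * (L : ℝ) ^ d := fun m z hz => abs_psiBox_le_local hκ hJ hA0 hA hb hz
  have hWbG : ∀ m, ∀ z : B1Eq324BenfattoLemma.Site d → ℝ, (∀ x ∈ J, x ∈ box L m → |z x| ≤ b) →
      |psi1p s D κ a L w v m z + psi2 s D κ a L w m z| ≤ 8 * (s1Const s D d κ * A * b ^ D * (L : ℝ) ^ d) :=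
    fun m z hz => abs_psi1p_add_psi2_le_local hκ hJ hA0 hA hb hz
  -- |z| ≤ b (resp. γb) on J on the small-field sets
  have hzJ : ∀ z ∈ smallFieldSet I b, ∀ x ∈ J, |z x| ≤ b := fun z hz x hx => by
    have h := hz x
    rwa [distToRegion_eq_zero_of_mem (hJI hx), add_zero, mul_one] at h
  have hzJ' : ∀ z ∈ smallFieldSet I (γ * b), ∀ x ∈ J, |z x| ≤ γ * b := fun z hz x hx => by
    have h := hz x
    rwa [distToRegion_eq_zero_of_mem (hJI hx), add_zero, mul_one] at h
  -- U1: (5.11) upwards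
  have hU1pt : ∀ z, cutoffBoltzmann (hamiltonian s D κ a J) I (γ * b) z ≤ Real.exp e511 * cutoffBoltzmann (hatH s D κ a L w B) I (γ * b) z := by
    intro z
    simp only [cutoffBoltzmann]
    by_cases hz : z ∈ smallFieldSet I (γ * b)
    · rw [Set.indicator_of_mem hz, Set.indicator_of_mem hz, ← Real.exp_add, Real.exp_le_exp]
      have h511 := abs_Hl_le_of_range hκ hJ hA0 hA hL hB hγb (hzJ' z hz) (s := s) (D := D) (w := w)
      have hsplit := hamiltonian_eq_hatH_add_Hl s D κ a J L w B z
      have := (abs_le.mp h511).2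
      linarith
    · rw [Set.indicator_of_notMem hz, Set.indicator_of_notMem hz, mul_zero]
  -- U2: the factorised form at `γ = 1` dominates `Π_Δχ̂_Δ e^{Ĥ}` pointwise
  have hU2pt : ∀ z, cutoffBoltzmann (hatH s D κ a L w B) I (γ * b) z ≤ IF z := by
    intro z
    have hF' : cutoffBoltzmann (hatH s D κ a L w B) I (γ * b) z = (smallFieldSet I (γ * b)).indicator (fun _ => (1 : ℝ)) z *
        Real.exp (hatH s D κ a L w B z) := by
      rw [cutoffBoltzmann]
      by_cases hz : z ∈ smallFieldSet I (γ * b)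
      · rw [Set.indicator_of_mem hz, Set.indicator_of_mem hz, one_mul]
      · rw [Set.indicator_of_notMem hz, Set.indicator_of_notMem hz, zero_mul]
    have hIFeq : IF z = ((smallFieldOn (Γ : Set (B1Eq324BenfattoLemma.Site d)) I (γ * b)).indicator (fun _ => (1 : ℝ)) z *
        ((smallFieldOn (out L B) I b).indicator (fun _ => (1 : ℝ)) z *
          ∏ m ∈ B, ((smallFieldOn (frame1 L w m : Set (B1Eq324BenfattoLemma.Site d)) I (γ * b)).indicator (fun _ => (1 : ℝ)) z *
              (smallFieldOn (shrink L m w : Set (B1Eq324BenfattoLemma.Site d)) I b).indicator (fun _ => (1 : ℝ)) z))) *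
        (Real.exp (hamiltonian s D κ a Γ z) * ∏ m ∈ B, Real.exp (psiBox s D κ a L w m z)) := by
      simp only [hIF]
      rw [Finset.prod_mul_distrib]
      ring
    rw [hF', hIFeq, exp_hatH_eq]
    exact mul_le_mul_of_nonneg_right (indicator_smallFieldSet_le_prod_gamma L w B I hγ hb0 z)
      (mul_nonneg (Real.exp_pos _).le (Finset.prod_nonneg fun m _ => (Real.exp_pos _).le))
  have hIFint : Integrable IF (condField d α β C zbar) :=
    integrable_boxes_integrand_of hκ hJ hA0 hA hJI B hγ hb (fun m z => psiBox s D κ a L w m z) (fun m => measurable_psiBox L w m) hWbF _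
  have hU12 : ∫ z, cutoffBoltzmann (hamiltonian s D κ a J) I (γ * b) z ∂condField d α β C zbar ≤ Real.exp e511 * ∫ z, IF z ∂condField d α β C zbar := by
    rw [← integral_const_mul]
    refine integral_mono_of_nonneg (Filter.Eventually.of_forall fun z => ?_) (hIFint.const_mul _)
      (Filter.Eventually.of_forall fun z => (hU1pt z).trans (mul_le_mul_of_nonneg_left (hU2pt z) (Real.exp_pos _).le))
    rw [cutoffBoltzmann]
    exact Set.indicator_nonneg (fun _ _ => (Real.exp_pos _).le) _
  -- the factorisation identity, forwards and backwards (γ = 1)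
  have hfacF : ∫ z, IF z ∂condField d α β C zbar = ∫ ξ, pre ξ * (OUT ξ * ∏ m ∈ B, F m ξ) ∂condField d α β C zbar :=
    integral_boxes_factorise_eq_cond hα hβ hκ hJ hA0 C zbar hA hJI hL hw B hγ hb (fun m z => psiBox s D κ a L w m z)
      (fun m z z' h => psiBox_congr_eqOn L w m h) (fun m => measurable_psiBox L w m) hWbF
  have hfacG : ∫ z, IG z ∂condField d α β C zbar = ∫ ξ, pre ξ * (OUT ξ * ∏ m ∈ B, G m ξ) ∂condField d α β C zbar :=
    integral_boxes_factorise_eq_cond hα hβ hκ hJ hA0 C zbar hA hJI hL hw B hγ hb (fun m z => psi1p s D κ a L w v m z + psi2 s D κ a L w m z)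
      (fun m z z' h => psi1p_add_psi2_congr_eqOn L w v m h) (fun m => measurable_psi1p_add_psi2 L w v m) hWbG
  -- U3: the per-box upper bounds inside the ξ-integral
  have hpre0 : ∀ ξ, 0 ≤ pre ξ := fun ξ => mul_nonneg (indicator_smallFieldOn_mem_Icc _ I _ ξ).1 (Real.exp_pos _).le
  have hOUT0 : ∀ ξ, 0 ≤ OUT ξ := fun ξ => integral_nonneg fun z => (indicator_smallFieldOn_mem_Icc _ I b z).1
  have hOUT1 : ∀ ξ, OUT ξ ≤ 1 := fun ξ => by
    have h := abs_integral_condField_le_of_bound hα hβ (C ∪ Γ) ξ (φ := fun z => (smallFieldOn (out L B) I b).indicator (fun _ => (1 : ℝ)) z) (M := 1)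
      fun z => by rw [abs_of_nonneg (indicator_smallFieldOn_mem_Icc _ I b z).1]; exact (indicator_smallFieldOn_mem_Icc _ I b z).2
    exact (le_abs_self _).trans h
  have hboxObs0 : ∀ (m : B1Eq324BenfattoLemma.Site d) (W : (B1Eq324BenfattoLemma.Site d → ℝ) → ℝ) (z : B1Eq324BenfattoLemma.Site d → ℝ),
      0 ≤ (smallFieldOn (frame1 L w m : Set (B1Eq324BenfattoLemma.Site d)) I (γ * b)).indicator (fun _ => (1 : ℝ)) z *
        (smallFieldOn (shrink L m w : Set (B1Eq324BenfattoLemma.Site d)) I b).indicator (fun _ => (1 : ℝ)) z * Real.exp (W z) := fun m W z =>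
    mul_nonneg (mul_nonneg (indicator_smallFieldOn_mem_Icc _ I _ z).1 (indicator_smallFieldOn_mem_Icc _ I _ z).1) (Real.exp_pos _).le
  have hG0 : ∀ m ξ, 0 ≤ G m ξ := fun m ξ =>
    integral_nonneg fun z => hboxObs0 m (fun z => psi1p s D κ a L w v m z + psi2 s D κ a L w m z) z
  have hF0 : ∀ m ξ, 0 ≤ F m ξ := fun m ξ => integral_nonneg fun z => hboxObs0 m (fun z => psiBox s D κ a L w m z) z
  have hKG : ∀ m ξ, |G m ξ| ≤ Real.exp (8 * (s1Const s D d κ * A * b ^ D * (L : ℝ) ^ d)) := fun m ξ =>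
    abs_integral_condField_le_of_bound hα hβ (C ∪ Γ) ξ fun z => abs_boxObs_le hJI hγ (zero_le_one.trans hb) m (hWbG m) z
  have hbox' : ∀ m ∈ B, ∀ ξ, ξ ∈ smallFieldOn (Γ : Set (B1Eq324BenfattoLemma.Site d)) I (γ * b) → (∀ c ∈ C, ξ c = zbar c) →
      F m ξ ≤ Real.exp (u m) * G m ξ := by
    intro m hm ξ hξ hC
    simp only [hF, hG]
    rw [boxFactor_eq_setIntegral_cond hα hβ C hm _ hξ, boxFactor_eq_setIntegral_cond hα hβ C hm _ hξ]
    exact hbox m hm ξ hξ hC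
  -- the per-box bounds are used ONLY for `ξ` with `ξ = z̄` on `C` (which holds `condField C z̄`-a.s.)
  have h3pt : ∀ ξ, (∀ c ∈ C, ξ c = zbar c) →
      pre ξ * (OUT ξ * ∏ m ∈ B, F m ξ) ≤ Real.exp (∑ m ∈ B, u m) * (pre ξ * (OUT ξ * ∏ m ∈ B, G m ξ)) := by
    intro ξ hC
    by_cases hξ : ξ ∈ smallFieldOn (Γ : Set (B1Eq324BenfattoLemma.Site d)) I (γ * b)
    swap
    · have hpre' : pre ξ = 0 := by
        simp only [hpre]
        rw [Set.indicator_of_notMem hξ, zero_mul]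
      rw [hpre', zero_mul, zero_mul, mul_zero]
    rw [Real.exp_sum]
    have hprod : ∏ m ∈ B, F m ξ ≤ (∏ m ∈ B, Real.exp (u m)) * ∏ m ∈ B, G m ξ := by
      rw [← Finset.prod_mul_distrib]
      exact Finset.prod_le_prod (fun m _ => hF0 m ξ) fun m hm => hbox' m hm ξ hξ hC
    calc pre ξ * (OUT ξ * ∏ m ∈ B, F m ξ) ≤ pre ξ * (OUT ξ * ((∏ m ∈ B, Real.exp (u m)) * ∏ m ∈ B, G m ξ)) :=
          mul_le_mul_of_nonneg_left (mul_le_mul_of_nonneg_left hprod (hOUT0 ξ)) (hpre0 ξ)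
      _ = (∏ m ∈ B, Real.exp (u m)) * (pre ξ * (OUT ξ * ∏ m ∈ B, G m ξ)) := by ring
  have hmeasG : Measurable fun ξ => pre ξ * (OUT ξ * ∏ m ∈ B, G m ξ) := by
    refine ((measurable_indicator_smallFieldOn _ I (γ * b)).mul (measurable_hamiltonian Γ).exp).mul
      ((measurable_integral_condField hα hβ (C ∪ Γ) (measurable_indicator_smallFieldOn _ I b)).mul (Finset.measurable_prod _ fun m _ => ?_))
    exact measurable_integral_condField hα hβ (C ∪ Γ)
      (((measurable_indicator_smallFieldOn _ I (γ * b)).mul (measurable_indicator_smallFieldOn _ I b)).mul (measurable_psi1p_add_psi2 L w v m).exp)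
  have hintG : Integrable (fun ξ => pre ξ * (OUT ξ * ∏ m ∈ B, G m ξ)) (condField d α β C zbar) := by
    refine Integrable.of_bound hmeasG.aestronglyMeasurable
      (Real.exp (s1Const s D d κ * A * b ^ D * Γ.card) * (1 * ∏ _m ∈ B, Real.exp (8 * (s1Const s D d κ * A * b ^ D * (L : ℝ) ^ d))))
      (ae_of_all _ fun ξ => ?_)
    rw [Real.norm_eq_abs]
    have hp : |pre ξ| ≤ Real.exp (s1Const s D d κ * A * b ^ D * Γ.card) := abs_corridorObs_le hκ hJ hA0 hA hJI hγ hb Γ ξ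
    have hrest : |OUT ξ * ∏ m ∈ B, G m ξ| ≤ 1 * ∏ _m ∈ B, Real.exp (8 * (s1Const s D d κ * A * b ^ D * (L : ℝ) ^ d)) := by
      rw [abs_mul, Finset.abs_prod, abs_of_nonneg (hOUT0 ξ)]
      exact mul_le_mul (hOUT1 ξ) (Finset.prod_le_prod (fun m _ => abs_nonneg _) fun m _ => hKG m ξ)
        (Finset.prod_nonneg fun m _ => abs_nonneg _) zero_le_one
    calc |pre ξ * (OUT ξ * ∏ m ∈ B, G m ξ)| = |pre ξ| * |OUT ξ * ∏ m ∈ B, G m ξ| := abs_mul _ _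
      _ ≤ _ := mul_le_mul hp hrest (abs_nonneg _) (Real.exp_pos _).le
  have hU3 : ∫ ξ, pre ξ * (OUT ξ * ∏ m ∈ B, F m ξ) ∂condField d α β C zbar
      ≤ Real.exp (∑ m ∈ B, u m) * ∫ ξ, pre ξ * (OUT ξ * ∏ m ∈ B, G m ξ) ∂condField d α β C zbar := by
    rw [← integral_const_mul]
    refine integral_mono_of_nonneg (Filter.Eventually.of_forall fun ξ =>
      mul_nonneg (hpre0 ξ) (mul_nonneg (hOUT0 ξ) (Finset.prod_nonneg fun m _ => hF0 m ξ))) (hintG.const_mul _) ?_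
    filter_upwards [condField_ae_eqOn hα hβ C zbar] with ξ hξC
    exact h3pt ξ hξC
  -- U4: backwards at `γ = 1`, the (5.34) error upwards
  have hU4pt : ∀ z, IG z ≤ Real.exp e534 * cutoffBoltzmann (hamiltonian s D κ a (corridorsBar L w v B)) I b z := by
    intro z
    have hIGeq : IG z = ((smallFieldOn (Γ : Set (B1Eq324BenfattoLemma.Site d)) I (γ * b)).indicator (fun _ => (1 : ℝ)) z *
        ((smallFieldOn (out L B) I b).indicator (fun _ => (1 : ℝ)) z *
          ∏ m ∈ B, (smallFieldOn (shrink L m w : Set (B1Eq324BenfattoLemma.Site d)) I b).indicator (fun _ => (1 : ℝ)) z)) *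
        (∏ m ∈ B, (smallFieldOn (frame1 L w m : Set (B1Eq324BenfattoLemma.Site d)) I (γ * b)).indicator (fun _ => (1 : ℝ)) z) *
        Real.exp (hamiltonian s D κ a Γ z + ∑ m ∈ B, (psi1p s D κ a L w v m z + psi2 s D κ a L w m z)) := by
      simp only [hIG]
      rw [Real.exp_add, Real.exp_sum, Finset.prod_mul_distrib, Finset.prod_mul_distrib]
      ring
    rw [hIGeq, cutoffBoltzmann]
    have hP := prod_indicator_le_indicator_smallFieldSet L w B I (γ := γ) (b := b) hγ hb0 z
    have hQ1 : ∏ m ∈ B, (smallFieldOn (frame1 L w m : Set (B1Eq324BenfattoLemma.Site d)) I (γ * b)).indicator (fun _ => (1 : ℝ)) z ≤ 1 :=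
      Finset.prod_le_one (fun m _ => (indicator_smallFieldOn_mem_Icc _ I _ z).1) fun m _ => (indicator_smallFieldOn_mem_Icc _ I _ z).2
    have hQ0 : 0 ≤ ∏ m ∈ B, (smallFieldOn (frame1 L w m : Set (B1Eq324BenfattoLemma.Site d)) I (γ * b)).indicator (fun _ => (1 : ℝ)) z :=
      Finset.prod_nonneg fun m _ => (indicator_smallFieldOn_mem_Icc _ I _ z).1
    by_cases hz : z ∈ smallFieldSet I b
    · rw [Set.indicator_of_mem hz, ← Real.exp_add]
      have h534 := abs_hamiltonian_corridorsBar_sub_sum_psi_le hκ hJ hA0 hA hL hv hb (hzJ z hz) (B := B) (s := s) (D := D)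
      have hexp : Real.exp (hamiltonian s D κ a Γ z + ∑ m ∈ B, (psi1p s D κ a L w v m z + psi2 s D κ a L w m z))
          ≤ Real.exp (e534 + hamiltonian s D κ a (corridorsBar L w v B) z) := by
        rw [Real.exp_le_exp]
        have := (abs_le.mp h534).1
        simp only [he534]
        linarith
      have hPQ : (smallFieldOn (Γ : Set (B1Eq324BenfattoLemma.Site d)) I (γ * b)).indicator (fun _ => (1 : ℝ)) z *
          ((smallFieldOn (out L B) I b).indicator (fun _ => (1 : ℝ)) z *
            ∏ m ∈ B, (smallFieldOn (shrink L m w : Set (B1Eq324BenfattoLemma.Site d)) I b).indicator (fun _ => (1 : ℝ)) z) *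
          (∏ m ∈ B, (smallFieldOn (frame1 L w m : Set (B1Eq324BenfattoLemma.Site d)) I (γ * b)).indicator (fun _ => (1 : ℝ)) z) ≤ 1 := by
        rw [Set.indicator_of_mem hz] at hP
        exact mul_le_one₀ hP hQ0 hQ1
      calc _ ≤ 1 * Real.exp (e534 + hamiltonian s D κ a (corridorsBar L w v B) z) :=
            mul_le_mul hPQ hexp (Real.exp_pos _).le zero_le_one
        _ = _ := by rw [one_mul]
    · rw [Set.indicator_of_notMem hz] at hP ⊢
      rw [mul_zero]
      have h0 : (smallFieldOn (Γ : Set (B1Eq324BenfattoLemma.Site d)) I (γ * b)).indicator (fun _ => (1 : ℝ)) z *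
          ((smallFieldOn (out L B) I b).indicator (fun _ => (1 : ℝ)) z *
            ∏ m ∈ B, (smallFieldOn (shrink L m w : Set (B1Eq324BenfattoLemma.Site d)) I b).indicator (fun _ => (1 : ℝ)) z) = 0 :=
        le_antisymm hP (mul_nonneg (indicator_smallFieldOn_mem_Icc _ I _ z).1 (mul_nonneg (indicator_smallFieldOn_mem_Icc _ I _ z).1
          (Finset.prod_nonneg fun m _ => (indicator_smallFieldOn_mem_Icc _ I _ z).1)))
      rw [h0, zero_mul, zero_mul]
  have hZint : Integrable (fun z => cutoffBoltzmann (hamiltonian s D κ a (corridorsBar L w v B)) I b z) (condField d α β C zbar) := by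
    refine Integrable.of_bound (measurable_cutoffBoltzmann_hamiltonian a _ I b).aestronglyMeasurable
      (Real.exp (s1Const s D d κ * A * b ^ D * (corridorsBar L w v B).card)) (ae_of_all _ fun z => ?_)
    rw [Real.norm_eq_abs, cutoffBoltzmann]
    by_cases hz : z ∈ smallFieldSet I b
    · rw [Set.indicator_of_mem hz, Real.abs_exp, Real.exp_le_exp]
      exact (le_abs_self _).trans (abs_hamiltonian_le hκ hJ hA0 hA _ hb (hzJ z hz))
    · rw [Set.indicator_of_notMem hz, abs_zero]
      exact (Real.exp_pos _).le
  have hU4 : ∫ z, IG z ∂condField d α β C zbar ≤ Real.exp e534 * ∫ z, cutoffBoltzmann (hamiltonian s D κ a (corridorsBar L w v B)) I b z ∂condField d α β C zbar := by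
    rw [← integral_const_mul]
    refine integral_mono_of_nonneg (Filter.Eventually.of_forall fun z => ?_) (hZint.const_mul _) (Filter.Eventually.of_forall hU4pt)
    exact mul_nonneg (mul_nonneg (indicator_smallFieldOn_mem_Icc _ I _ z).1 (Real.exp_pos _).le)
      (mul_nonneg (indicator_smallFieldOn_mem_Icc _ I _ z).1 (Finset.prod_nonneg fun m _ =>
        hboxObs0 m (fun z => psi1p s D κ a L w v m z + psi2 s D κ a L w m z) z))
  -- U5: the next datum
  have h5 : ∫ z, cutoffBoltzmann (hamiltonian s D κ a (corridorsBar L w v B)) I b z ∂condField d α β C zbar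
      = ∫ z, cutoffBoltzmann (hamiltonian s D κ (restrictCoef a (corridorsBar L w v B)) (J ∩ corridorsBar L w v B)) I b z ∂condField d α β C zbar :=
    integral_congr_ae (Filter.Eventually.of_forall fun z => cutoffBoltzmann_hamiltonian_eq_restrict hJ _ I b z)
  -- chain
  rw [← h5]
  calc ∫ z, cutoffBoltzmann (hamiltonian s D κ a J) I (γ * b) z ∂condField d α β C zbar ≤ Real.exp e511 * ∫ z, IF z ∂condField d α β C zbar := hU12
    _ = Real.exp e511 * ∫ ξ, pre ξ * (OUT ξ * ∏ m ∈ B, F m ξ) ∂condField d α β C zbar := by rw [hfacF]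
    _ ≤ Real.exp e511 * (Real.exp (∑ m ∈ B, u m) * ∫ ξ, pre ξ * (OUT ξ * ∏ m ∈ B, G m ξ) ∂condField d α β C zbar) :=
        mul_le_mul_of_nonneg_left hU3 (Real.exp_pos _).le
    _ = Real.exp e511 * (Real.exp (∑ m ∈ B, u m) * ∫ z, IG z ∂condField d α β C zbar) := by rw [hfacG]
    _ ≤ Real.exp e511 * (Real.exp (∑ m ∈ B, u m) *
          (Real.exp e534 * ∫ z, cutoffBoltzmann (hamiltonian s D κ a (corridorsBar L w v B)) I b z ∂condField d α β C zbar)) :=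
        mul_le_mul_of_nonneg_left (mul_le_mul_of_nonneg_left hU4 (Real.exp_pos _).le) (Real.exp_pos _).le
    _ = _ := by
        rw [show e511 + e534 + ∑ m ∈ B, u m = e511 + (∑ m ∈ B, u m + e534) by ring, Real.exp_add, Real.exp_add]
        ring

end UpperGammaPrime

/-! ## §3  The same step for ANY `z̄`, per-box hypotheses only at `ξ` small on `C ∪ Γ₁` -/

section UpperGammaUnion

variable {s D : ℕ} {κ : ℝ} {a : Coef d} {J I : Finset (B1Eq324BenfattoLemma.Site d)} {L w v : ℕ}
  {B : Finset (B1Eq324BenfattoLemma.Site d)} {γ b A : ℝ}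

/-- **THE UPPER PAVEMENT STEP UNDER `P̄` IN SUPPLIER FORM** — the conclusion of `upperPavementStep_cond_of_setIntegral_gamma'` for ANY conditioning
values `z̄`, with the per-box UPPER hypotheses asked only for `ξ` small on the WHOLE conditioning set `C ∪ Γ₁` at threshold `γb`
(`ξ ∈ smallFieldOn ↑(C ∪ corridors L w B) I (γb)`, i.e. `|ξ_c| ≤ γb(1 + d(c, I))` for all `c ∈ C ∪ Γ₁` — literally the `hξ` of the per-box supplier
`…Sect5PerBoxAppD.perBox_condField_appD` at `Γ := C ∪ Γ₁`).  Case split on print's assumption *"|z_Δ| ≦ b(1 + d(Δ, I)), ∀Δ ∈ C"* (p. 159) at the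
input threshold `γb`: if `z̄` is small on `C`, every `ξ` with `ξ = z̄` on `C` and `χ^{Γ₁}_{γb}(ξ) = 1` is small on `C ∪ Γ₁` and §2 applies; if not, the
left-hand side is `0` (§1) and the right-hand side is non-negative. [cite: BenfattoEtAl1978, §5 (5.36) p.159, (4.6) p.152] -/
theorem upperPavementStep_cond_of_setIntegral_gamma_union (hα : 0 < α) (hβ : 0 < β) (hκ : 0 < κ) (hJ : CoefSupportedIn a J) (hA0 : 0 ≤ A)
    (C : Finset (B1Eq324BenfattoLemma.Site d)) (zbar : B1Eq324BenfattoLemma.Site d → ℝ)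
    (hA : ∀ p ∈ Finset.Icc 1 s, ∀ (Δ : Fin p → B1Eq324BenfattoLemma.Site d), (∀ i, Δ i ∈ J) →
      ∀ n ∈ admissible p D, |a p Δ n| ≤ A)
    (hJI : J ⊆ I) (hL : 0 < L) (hw : 1 ≤ w) (hv : v ≤ w) (hB : J.image (boxIndex L) ⊆ B) (hγ : γ ≤ 1) (hb : 1 ≤ b) (hγb : 1 ≤ γ * b)
    (u : B1Eq324BenfattoLemma.Site d → ℝ)
    (hbox : ∀ m ∈ B, ∀ ξ : B1Eq324BenfattoLemma.Site d → ℝ,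
      ξ ∈ smallFieldOn ((C ∪ corridors L w B : Finset (B1Eq324BenfattoLemma.Site d)) : Set (B1Eq324BenfattoLemma.Site d)) I (γ * b) →
      ∫ z in smallFieldOn (shrink L m w : Set (B1Eq324BenfattoLemma.Site d)) I b,
          Real.exp (psiBox s D κ a L w m z) ∂condField d α β (C ∪ corridors L w B) ξ
        ≤ Real.exp (u m) * ∫ z in smallFieldOn (shrink L m w : Set (B1Eq324BenfattoLemma.Site d)) I b,
          Real.exp (psi1p s D κ a L w v m z + psi2 s D κ a L w m z) ∂condField d α β (C ∪ corridors L w B) ξ) :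
    ∫ z, cutoffBoltzmann (hamiltonian s D κ a J) I (γ * b) z ∂condField d α β C zbar ≤
      Real.exp (s1Const s D d κ * A * (γ * b) ^ D * Real.exp (-(κ / 4 * w)) * J.card
        + s1Const s D d κ * A * b ^ D *
          (Real.exp (-(κ / 4 * w)) * (corridorsBar L w v B).card + Real.exp (-(κ / 4 * v)) * (B.card * (L : ℝ) ^ d))
        + ∑ m ∈ B, u m) *
        ∫ z, cutoffBoltzmann (hamiltonian s D κ (restrictCoef a (corridorsBar L w v B)) (J ∩ corridorsBar L w v B)) I b z ∂condField d α β C zbar := by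
  by_cases hz : zbar ∈ smallFieldOn (C : Set (B1Eq324BenfattoLemma.Site d)) I (γ * b)
  · refine upperPavementStep_cond_of_setIntegral_gamma' hα hβ hκ hJ hA0 C zbar hA hJI hL hw hv hB hγ hb hγb u fun m hm ξ hξ hC => hbox m hm ξ ?_
    intro x hx
    rcases Finset.mem_union.mp (Finset.mem_coe.mp hx) with hxC | hxΓ
    · rw [hC x hxC]
      exact hz x (Finset.mem_coe.mpr hxC)
    · exact hξ x (Finset.mem_coe.mpr hxΓ)
  · rw [integral_cutoffBoltzmann_condField_eq_zero_of_not_mem hα hβ C zbar _ I hz]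
    exact mul_nonneg (Real.exp_pos _).le (integral_cutoffBoltzmann_nonneg _ _ I b)

end UpperGammaUnion

end Literature.MathematicalPhysics.QuantumFieldTheory.Balaban1983to89.B1Eq324BenfattoSect5UpperStep

end
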